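import Literature.AlgebraicGeometry.HodgeTheory.AbelianSixfoldsRealOrQuaternionMultiplicationHodgeClasses
import Literature.AlgebraicGeometry.HodgeTheory.GenericAbelianFivefoldPowersHodgeClasses
import Literature.AlgebraicGeometry.HodgeTheory.AbelianThreefoldsStablyNondegenerate
import HarnessLib

/-!
# Abelian varieties of dimension `≤ 7` with real multiplication (`End⁰(A)` a totally real field; `End⁰(A) = ℚ` excluded in dimensions `4, 6, 7`) and SIMPLE abelian varieties of dimension `≤ 7` of type II (`End⁰(A)` a totally indefinite quaternion algebra over a totally real field) are stably nondegenerate: `B•(Aⁿ) = D•(Aⁿ)` and the Hodge conjecture for all powers and for their products with every stably nondegenerate variety — UNCONDITIONAL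

Family `hodge`, layer `Literature/AlgebraicGeometry/HodgeTheory`. Research context: cell `pub-hodge-ring2` (HONEST FRAMING:
research route conditional on HC_CM; not a corollary; Q11.4-sentence-2 already refuted in dim ≥ 3), Literature lane gen 82: the
low-dimensional census of the tree's UNCONDITIONAL condition-(D) theorems for Albert types I (commutative, totally real) and II,
assembled by the arithmetic `[F:ℚ] ∣ dim A` (type I, `AbelianVariety.finrank_endAlgebra_dvd_dim_of_isTotallyReal_endField`) and
`4[K:ℚ] = [D:ℚ] ∣ 2 dim A` (type II, the tree's `finrank_endAlgebra_dvd_two_mul_dim`) from: dimension `≤ 3` (the tree's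
`isStablyNondegenerate_of_dim_pos_of_dim_le_three`, Moonen–Zarhin 1999 Thm. 0.1 (4)), relative dimension one (Ribet 1983
Thm. 0, `isStablyNondegenerate_of_isTotallyReal`), two (`isStablyNondegenerate_of_isTotallyReal_of_two_mul_finrank_eq`), three
(Ribet Thm. 1 with `d/e = 3`, programme R59), the generic fivefold (`End⁰ = ℚ`, `dim = 5`: Moonen–Zarhin (2.6)–(2.7), the tree's
`AbelianVariety.isDivisorGenerated_powSucc_of_fivefold_endRankOne`), quaternion rank one
(`AbelianVariety.isDivisorGenerated_powSucc_of_isSimple_isTotallyIndefinite`), two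
(`isStablyNondegenerate_of_isSimple_isTotallyIndefinite_rankTwo`) and three (programme R60). THEOREMS ONLY (no definition, no
named fact; D-0026); UNCONDITIONAL.

NOT COVERED (hypothesis `hex`): `End⁰(A) = ℚ` with `dim A = 4` (Mumford's fourfolds: condition (D) genuinely FAILS for some of
them, Mumford 1969 §4 / Moonen–Zarhin 1999 (2.5)), `dim A = 6` and `dim A = 7` (`Hg = Sp₁₂`, `Sp₁₄` for `End⁰ = ℚ` are theorems
in print — Tankeev, Ribet: `g` odd or outside the exceptional set — but are named facts, not theorems, in the tree:
`TankeevRibet1983_…_simplePrimeDimension`, `Tankeev1996_…_notEx1`).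

* §1 **`isStablyNondegenerate_of_isTotallyReal_endField_of_dim_le_seven`** (positivity of `dim A` by the tree's
  `AbelianVariety.dim_pos_of_isField_endAlgebra`);
  HC for all powers, everything isogenous; `IsStablyNondegenerate.prod_isTotallyReal_endField_of_dim_le_seven` (Hazama for a
  type I factor, the tree's `IsStablyNondegenerate.prod_of_isTotallyReal_endField_right`).
* §2 **`isStablyNondegenerate_of_isSimple_isTotallyIndefinite_of_dim_le_seven`** (every simple type II abelian variety of
  dimension `≤ 7`); HC for all powers, everything isogenous; `IsStablyNondegenerate.prod_isSimple_isTotallyIndefinite_of_dim_le_seven`.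

## References

* [MoonenZarhin1999LowDim] B. Moonen, Yu. Zarhin, Math. Ann. 315 (1999), Thm. 0.1, §2 (2.1)–(2.7).
  [cite: MoonenZarhin1999LowDim, Thm. 0.1 (4), (5.2) and Introduction (p. 1)]
* [Ribet1983] K. A. Ribet, Amer. J. Math. 105 (1983), Thms. 0–1. [cite: Ribet1983, Thms. 0 and 1]
* [Gordon1997] B. B. Gordon, arXiv:alg-geom/9709030, Thm. 6.3, Thm. 7.2. [cite: Gordon1997, Thm. 7.2 (arXiv:alg-geom/9709030 p. 20)]
* [BanaszakGajdaKrason2006] G. Banaszak, W. Gajda, P. Krasoń, Doc. Math. Extra Vol. Coates (2006), Cor. 7.19, Thm. 7.34.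
  [cite: BanaszakGajdaKrason2006, Cor. 7.19 and Thm. 7.34]
* [MoonenZarhin1995Duke] B. Moonen, Yu. Zarhin, Duke Math. J. 77 (1995). [cite: MoonenZarhin1995Duke, Type II]
* [Hazama1989] F. Hazama, Duke Math. J. 58 (1989). [cite: Hazama1989, Thm. (= Gordon 7.6.2)]
* [Mumford1969NoteShimura] D. Mumford, Math. Ann. 181 (1969), §4. [cite: Mumford1969NoteShimura, §4]
* [MumfordAV1970] D. Mumford, *Abelian Varieties* (1970), §19. [cite: MumfordAV1970, §19 Cor. 2 of Thm. 1 (p. 174)]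
* [LangeBirkenhake1992] H. Lange, Ch. Birkenhake, *Complex Abelian Varieties* (1992), Prop. 1.2.3. [cite: LangeBirkenhake1992, Prop. 1.2.3]
* [vanGeemen1994HodgeAV] B. van Geemen, LNM 1594 (1994), Lemma 3.7. [cite: vanGeemen1994HodgeAV, Lemma 3.7]
* [Deligne2000] P. Deligne, *The Hodge conjecture* (Clay, 2000), §1. [cite: Deligne2000, §1]
-/

noncomputable section

open CategoryTheory Module NumberField

namespace Literature.AlgebraicGeometry.HodgeTheory

open Literature.AlgebraicTopology.SingularHomology
open Literature.AlgebraicGeometry.Motives (AbelianVariety bettiCohomology)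
open Literature.Barriers.HodgeConjecture
open Literature.AlgebraicGeometry.Motives.HodgeStructure
open Literature.AlgebraicGeometry.ComplexMultiplication
open Literature.RingTheory.CentralSimple
open Literature.NumberTheory.Automorphic (IsQuaternionAlgebra)

/-! ### §1 Type I: `End⁰(A)` a totally real field, `dim A ≤ 7` -/

section TypeI

variable {A B : AbelianVariety ℂ}

variable (A) in
/-- **Every abelian variety of dimension `≤ 7` whose endomorphism algebra is a totally real field `F` is stably nondegenerate,
except possibly when `F = ℚ` and `dim A ∈ {4, 6, 7}`** (hypothesis `hex`) — UNCONDITIONAL. `[F:ℚ] ∣ dim A`; dimension `≤ 3`: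
Moonen–Zarhin Thm. 0.1 (4) (the tree's `isStablyNondegenerate_of_dim_pos_of_dim_le_three`); relative dimension `1, 2, 3`: Ribet
Thm. 0, the tree's relative dimension two, Ribet Thm. 1 with `d/e = 3` (R59); `End⁰ = ℚ`, `dim = 5`: Moonen–Zarhin (2.6).
[cite: MoonenZarhin1999LowDim, Thm. 0.1 (4), (5.2) and Introduction (p. 1)] [cite: Ribet1983, Thms. 0 and 1]
[cite: Gordon1997, Thm. 7.2 (arXiv:alg-geom/9709030 p. 20)] -/
theorem isStablyNondegenerate_of_isTotallyReal_endField_of_dim_le_seven (hF : IsField A.endAlgebra)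
    [IsTotallyReal (EndField A hF)] (h7 : A.dim ≤ 7)
    (hex : Module.finrank ℚ A.endAlgebra = 1 → A.dim ≠ 4 ∧ A.dim ≠ 6 ∧ A.dim ≠ 7) : IsStablyNondegenerate A := by
  have h0 : 0 < A.dim := AbelianVariety.dim_pos_of_isField_endAlgebra hF
  by_cases h3 : A.dim ≤ 3
  · exact isStablyNondegenerate_of_dim_pos_of_dim_le_three h0 h3
  have hdvd := AbelianVariety.finrank_endAlgebra_dvd_dim_of_isTotallyReal_endField A hF
  have hepos : 0 < Module.finrank ℚ A.endAlgebra := Nat.pos_of_dvd_of_pos hdvd h0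
  have hele : Module.finrank ℚ A.endAlgebra ≤ A.dim := Nat.le_of_dvd h0 hdvd
  interval_cases hd : A.dim
  · -- `dim A = 4`: `[F:ℚ] ∈ {2, 4}` (`F = ℚ` is excluded)
    have hle : Module.finrank ℚ A.endAlgebra ≤ 4 := hele
    interval_cases he : Module.finrank ℚ A.endAlgebra
    · exact absurd rfl (hex rfl).1
    · exact isStablyNondegenerate_of_isTotallyReal_of_two_mul_finrank_eq A hF (by rw [hd, he])
    · exact absurd hdvd (by decide)
    · exact isStablyNondegenerate_of_isTotallyReal A hF (by rw [hd, he])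
  · -- `dim A = 5`: `[F:ℚ] ∈ {1, 5}`
    have hle : Module.finrank ℚ A.endAlgebra ≤ 5 := hele
    interval_cases he : Module.finrank ℚ A.endAlgebra
    · exact fun N => AbelianVariety.isDivisorGenerated_powSucc_of_fivefold_endRankOne A he hd N
    · exact absurd hdvd (by decide)
    · exact absurd hdvd (by decide)
    · exact absurd hdvd (by decide)
    · exact isStablyNondegenerate_of_isTotallyReal A hF (by rw [hd, he])
  · -- `dim A = 6`: `[F:ℚ] ∈ {2, 3, 6}`
    have hle : Module.finrank ℚ A.endAlgebra ≤ 6 := hele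
    interval_cases he : Module.finrank ℚ A.endAlgebra
    · exact absurd rfl (hex rfl).2.1
    · exact isStablyNondegenerate_of_isTotallyReal_of_three_mul_finrank_eq A hF (by rw [hd, he])
    · exact isStablyNondegenerate_of_isTotallyReal_of_two_mul_finrank_eq A hF (by rw [hd, he])
    · exact absurd hdvd (by decide)
    · exact absurd hdvd (by decide)
    · exact isStablyNondegenerate_of_isTotallyReal A hF (by rw [hd, he])
  · -- `dim A = 7`: `[F:ℚ] = 7`
    have hle : Module.finrank ℚ A.endAlgebra ≤ 7 := hele
    interval_cases he : Module.finrank ℚ A.endAlgebra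
    · exact absurd rfl (hex rfl).2.2
    · exact absurd hdvd (by decide)
    · exact absurd hdvd (by decide)
    · exact absurd hdvd (by decide)
    · exact absurd hdvd (by decide)
    · exact absurd hdvd (by decide)
    · exact isStablyNondegenerate_of_isTotallyReal A hF (by rw [hd, he])

variable (A) in
/-- **`B•(Aⁿ⁺¹) = D•(Aⁿ⁺¹) ⊗ ℂ`** under the same hypotheses. [cite: MoonenZarhin1999LowDim, Thm. 0.1 (4), (5.2) and Introduction (p. 1)]
[cite: Ribet1983, Thms. 0 and 1] -/
theorem AbelianVariety.isDivisorGenerated_powSucc_of_isTotallyReal_endField_of_dim_le_seven (hF : IsField A.endAlgebra)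
    [IsTotallyReal (EndField A hF)] (h7 : A.dim ≤ 7)
    (hex : Module.finrank ℚ A.endAlgebra = 1 → A.dim ≠ 4 ∧ A.dim ≠ 6 ∧ A.dim ≠ 7) (N : ℕ) :
    IsDivisorGenerated (A.powSucc N) :=
  isStablyNondegenerate_of_isTotallyReal_endField_of_dim_le_seven A hF h7 hex N

/-- **The Hodge conjecture for all powers** under the same hypotheses — UNCONDITIONAL. [cite: MoonenZarhin1999LowDim, Thm. 0.1 (4), (5.2) and Introduction (p. 1)]
[cite: Ribet1983, Thms. 0 and 1] [cite: Deligne2000, §1] -/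
theorem hodgeConjectureFor_powSucc_of_isTotallyReal_endField_of_dim_le_seven (hF : IsField A.endAlgebra)
    [IsTotallyReal (EndField A hF)] (h7 : A.dim ≤ 7)
    (hex : Module.finrank ℚ A.endAlgebra = 1 → A.dim ≠ 4 ∧ A.dim ≠ 6 ∧ A.dim ≠ 7) (N : ℕ) :
    HodgeConjectureFor (A.powSucc N).dim (A.powSucc N).X :=
  (isStablyNondegenerate_of_isTotallyReal_endField_of_dim_le_seven A hF h7 hex).hodgeConjectureFor_powSucc N

/-- The variety itself. [cite: MoonenZarhin1999LowDim, Thm. 0.1 (4), (5.2) and Introduction (p. 1)] [cite: Deligne2000, §1] -/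
theorem hodgeConjectureFor_of_isTotallyReal_endField_of_dim_le_seven (hF : IsField A.endAlgebra)
    [IsTotallyReal (EndField A hF)] (h7 : A.dim ≤ 7)
    (hex : Module.finrank ℚ A.endAlgebra = 1 → A.dim ≠ 4 ∧ A.dim ≠ 6 ∧ A.dim ≠ 7) : HodgeConjectureFor A.dim A.X :=
  (isStablyNondegenerate_of_isTotallyReal_endField_of_dim_le_seven A hF h7 hex).hodgeConjectureFor

/-- Everything isogenous to a power `A^{N+1}`. [cite: vanGeemen1994HodgeAV, Lemma 3.7] [cite: Ribet1983, Thms. 0 and 1] -/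
theorem hodgeConjectureFor_of_isIsogenous_powSucc_of_isTotallyReal_endField_of_dim_le_seven (hF : IsField A.endAlgebra)
    [IsTotallyReal (EndField A hF)] (h7 : A.dim ≤ 7)
    (hex : Module.finrank ℚ A.endAlgebra = 1 → A.dim ≠ 4 ∧ A.dim ≠ 6 ∧ A.dim ≠ 7) {X : AbelianVariety ℂ} {N : ℕ}
    (hX : AbelianVariety.IsIsogenous X (A.powSucc N)) : HodgeConjectureFor X.dim X.X :=
  (isStablyNondegenerate_of_isTotallyReal_endField_of_dim_le_seven A hF h7 hex).hodgeConjectureFor_of_isIsogenous_powSucc hX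

/-- **ANY stably nondegenerate variety times such an `A` is stably nondegenerate** (Hazama's theorem for a type I factor).
[cite: Hazama1989, Thm. (= Gordon 7.6.2)] [cite: Ribet1983, Thms. 0 and 1] -/
theorem IsStablyNondegenerate.prod_isTotallyReal_endField_of_dim_le_seven (hB : IsStablyNondegenerate B)
    (hF : IsField A.endAlgebra) [IsTotallyReal (EndField A hF)] (h7 : A.dim ≤ 7)
    (hex : Module.finrank ℚ A.endAlgebra = 1 → A.dim ≠ 4 ∧ A.dim ≠ 6 ∧ A.dim ≠ 7) : IsStablyNondegenerate (B.prod A) :=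
  hB.prod_of_isTotallyReal_endField_right (isStablyNondegenerate_of_isTotallyReal_endField_of_dim_le_seven A hF h7 hex) hF

/-- HC for everything isogenous to a power of `B^{M+1} × A^{N+1}` — UNCONDITIONAL. [cite: Hazama1989, Thm. (= Gordon 7.6.2)]
[cite: vanGeemen1994HodgeAV, Lemma 3.7] -/
theorem hodgeConjectureFor_of_isIsogenous_powSucc_powSucc_prod_powSucc_isTotallyReal_endField_of_dim_le_seven
    (hB : IsStablyNondegenerate B) (hF : IsField A.endAlgebra) [IsTotallyReal (EndField A hF)] (h7 : A.dim ≤ 7)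
    (hex : Module.finrank ℚ A.endAlgebra = 1 → A.dim ≠ 4 ∧ A.dim ≠ 6 ∧ A.dim ≠ 7) {X : AbelianVariety ℂ} {M N L : ℕ}
    (hX : AbelianVariety.IsIsogenous X (((B.powSucc M).prod (A.powSucc N)).powSucc L)) : HodgeConjectureFor X.dim X.X :=
  ((hB.prod_isTotallyReal_endField_of_dim_le_seven hF h7 hex).powSucc_prod_powSucc M N).hodgeConjectureFor_of_isIsogenous_powSucc
    hX

end TypeI

/-! ### §2 Type II: `A` simple, `End⁰(A)` a totally indefinite quaternion algebra over a totally real field, `dim A ≤ 7` -/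

section TypeII

variable {A B : AbelianVariety ℂ} {K : Type} [Field K] [NumberField K] [Algebra K A.endAlgebra]
  [IsScalarTower ℚ K A.endAlgebra] [IsQuaternionAlgebra K A.endAlgebra]

variable (A) in
/-- **Every SIMPLE abelian variety of dimension `≤ 7` whose endomorphism algebra is a totally indefinite quaternion algebra
over a totally real field is stably nondegenerate — UNCONDITIONAL.** `4[K:ℚ] ∣ 2 dim A`, so `dim A ∈ {2, 4, 6}` with
`[K:ℚ] ∣ dim A / 2`: quaternion rank one (`dim A = 2[K:ℚ]`), two (`dim A = 4`, `K = ℚ`: Moonen–Zarhin 1995) or three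
(`dim A = 6`, `K = ℚ`: R60); dimension `≤ 3` by the tree's `isStablyNondegenerate_of_dim_pos_of_dim_le_three`.
[cite: MoonenZarhin1999LowDim, Thm. 0.1 (4), (5.2) and Introduction (p. 1)] [cite: MoonenZarhin1995Duke, Type II]
[cite: Gordon1997, Thm. 7.2 (arXiv:alg-geom/9709030 p. 20)] [cite: BanaszakGajdaKrason2006, Cor. 7.19 and Thm. 7.34] -/
theorem isStablyNondegenerate_of_isSimple_isTotallyIndefinite_of_dim_le_seven [IsTotallyReal K] (hA : A.IsSimple)
    (hind : IsTotallyIndefinite K A.endAlgebra) (h7 : A.dim ≤ 7) : IsStablyNondegenerate A := by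
  have h0 : 0 < A.dim := dim_pos_of_isQuaternionAlgebra K
  by_cases h3 : A.dim ≤ 3
  · exact isStablyNondegenerate_of_dim_pos_of_dim_le_three h0 h3
  obtain ⟨Φ⟩ := nonempty_realSplitting_of_isSimple_isTotallyIndefinite hA hind
  have h4 : Module.finrank ℚ A.endAlgebra = 2 * (2 * Module.finrank ℚ K) := by
    rw [RealSplitting.finrank_eq_four_mul_card Φ, card_infinitePlace_eq_finrank_of_isTotallyReal K]
    ring
  have hdvd := finrank_endAlgebra_dvd_two_mul_dim hA
  rw [h4] at hdvd
  have hdvd2 : 2 * Module.finrank ℚ K ∣ A.dim := Nat.dvd_of_mul_dvd_mul_left (by norm_num) hdvd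
  have hpos : 0 < 2 * Module.finrank ℚ K := Nat.pos_of_dvd_of_pos hdvd2 h0
  have hKpos : 0 < Module.finrank ℚ K := by omega
  have hle : 2 * Module.finrank ℚ K ≤ A.dim := Nat.le_of_dvd h0 hdvd2
  interval_cases hd : A.dim
  · -- `dim A = 4`: `[K:ℚ] ∈ {1, 2}`
    have hle' : Module.finrank ℚ K ≤ 2 := by omega
    interval_cases he : Module.finrank ℚ K
    · exact isStablyNondegenerate_of_isSimple_isTotallyIndefinite_rankTwo A hA hind (by rw [hd, he])
    · exact fun N => AbelianVariety.isDivisorGenerated_powSucc_of_isSimple_isTotallyIndefinite A hA hind (by rw [hd, he]) N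
  · -- `dim A = 5`: impossible
    have hle' : Module.finrank ℚ K ≤ 2 := by omega
    interval_cases he : Module.finrank ℚ K <;> exact absurd hdvd2 (by decide)
  · exact isStablyNondegenerate_of_isSimple_sixfold_isTotallyIndefinite A hA hind hd
  · -- `dim A = 7`: impossible
    have hle' : Module.finrank ℚ K ≤ 3 := by omega
    interval_cases he : Module.finrank ℚ K <;> exact absurd hdvd2 (by decide)

variable (A) in
/-- **`B•(Aⁿ⁺¹) = D•(Aⁿ⁺¹) ⊗ ℂ`** for every simple type II abelian variety of dimension `≤ 7`.
[cite: MoonenZarhin1999LowDim, Thm. 0.1 (4), (5.2) and Introduction (p. 1)] [cite: Gordon1997, Thm. 7.2 (arXiv:alg-geom/9709030 p. 20)] -/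
theorem AbelianVariety.isDivisorGenerated_powSucc_of_isSimple_isTotallyIndefinite_of_dim_le_seven [IsTotallyReal K]
    (hA : A.IsSimple) (hind : IsTotallyIndefinite K A.endAlgebra) (h7 : A.dim ≤ 7) (N : ℕ) :
    IsDivisorGenerated (A.powSucc N) :=
  isStablyNondegenerate_of_isSimple_isTotallyIndefinite_of_dim_le_seven A hA hind h7 N

/-- **The Hodge conjecture for all powers of every simple type II abelian variety of dimension `≤ 7` — UNCONDITIONAL.**
[cite: MoonenZarhin1999LowDim, Thm. 0.1 (4), (5.2) and Introduction (p. 1)] [cite: Gordon1997, Thm. 7.2 (arXiv:alg-geom/9709030 p. 20)]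
[cite: Deligne2000, §1] -/
theorem hodgeConjectureFor_powSucc_of_isSimple_isTotallyIndefinite_of_dim_le_seven [IsTotallyReal K] (hA : A.IsSimple)
    (hind : IsTotallyIndefinite K A.endAlgebra) (h7 : A.dim ≤ 7) (N : ℕ) :
    HodgeConjectureFor (A.powSucc N).dim (A.powSucc N).X :=
  (isStablyNondegenerate_of_isSimple_isTotallyIndefinite_of_dim_le_seven A hA hind h7).hodgeConjectureFor_powSucc N

/-- The variety itself. [cite: MoonenZarhin1999LowDim, Thm. 0.1 (4), (5.2) and Introduction (p. 1)] [cite: Deligne2000, §1] -/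
theorem hodgeConjectureFor_of_isSimple_isTotallyIndefinite_of_dim_le_seven [IsTotallyReal K] (hA : A.IsSimple)
    (hind : IsTotallyIndefinite K A.endAlgebra) (h7 : A.dim ≤ 7) : HodgeConjectureFor A.dim A.X :=
  (isStablyNondegenerate_of_isSimple_isTotallyIndefinite_of_dim_le_seven A hA hind h7).hodgeConjectureFor

/-- Everything isogenous to a power `A^{N+1}`. [cite: vanGeemen1994HodgeAV, Lemma 3.7] [cite: Gordon1997, Thm. 7.2 (arXiv:alg-geom/9709030 p. 20)] -/
theorem hodgeConjectureFor_of_isIsogenous_powSucc_of_isSimple_isTotallyIndefinite_of_dim_le_seven [IsTotallyReal K]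
    (hA : A.IsSimple) (hind : IsTotallyIndefinite K A.endAlgebra) (h7 : A.dim ≤ 7) {X : AbelianVariety ℂ} {N : ℕ}
    (hX : AbelianVariety.IsIsogenous X (A.powSucc N)) : HodgeConjectureFor X.dim X.X :=
  (isStablyNondegenerate_of_isSimple_isTotallyIndefinite_of_dim_le_seven A hA hind h7).hodgeConjectureFor_of_isIsogenous_powSucc
    hX

/-- **ANY stably nondegenerate variety times a simple type II abelian variety of dimension `≤ 7` is stably nondegenerate**
(Hazama's theorem for a type II factor). [cite: Hazama1989, Thm. (= Gordon 7.6.2)] [cite: Gordon1997, Thm. 7.2 (arXiv:alg-geom/9709030 p. 20)] -/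
theorem IsStablyNondegenerate.prod_isSimple_isTotallyIndefinite_of_dim_le_seven [IsTotallyReal K]
    (hB : IsStablyNondegenerate B) (hA : A.IsSimple) (hind : IsTotallyIndefinite K A.endAlgebra) (h7 : A.dim ≤ 7) :
    IsStablyNondegenerate (B.prod A) :=
  hB.prod_of_isSimple_isTotallyIndefinite_right
    (isStablyNondegenerate_of_isSimple_isTotallyIndefinite_of_dim_le_seven A hA hind h7) hA hind

/-- HC for everything isogenous to a power of `B^{M+1} × A^{N+1}` — UNCONDITIONAL. [cite: Hazama1989, Thm. (= Gordon 7.6.2)]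
[cite: vanGeemen1994HodgeAV, Lemma 3.7] -/
theorem hodgeConjectureFor_of_isIsogenous_powSucc_powSucc_prod_powSucc_isSimple_isTotallyIndefinite_of_dim_le_seven
    [IsTotallyReal K] (hB : IsStablyNondegenerate B) (hA : A.IsSimple) (hind : IsTotallyIndefinite K A.endAlgebra)
    (h7 : A.dim ≤ 7) {X : AbelianVariety ℂ} {M N L : ℕ}
    (hX : AbelianVariety.IsIsogenous X (((B.powSucc M).prod (A.powSucc N)).powSucc L)) : HodgeConjectureFor X.dim X.X :=
  ((hB.prod_isSimple_isTotallyIndefinite_of_dim_le_seven hA hind h7).powSucc_prod_powSucc M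
    N).hodgeConjectureFor_of_isIsogenous_powSucc hX

end TypeII

end Literature.AlgebraicGeometry.HodgeTheory

end
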